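import Summits.Schanuel.Schanuel.Theorems.RootDecomp1EPointTransfer02

/-!
# RootDecomp1EPointTransfer — lens 2, generation 36 «POINT-TRANSFER CELL» (PointTransfer.lean v2 3559bc07…, 1387 l) — continuation (RootDecomp1EPointTransfer03): §5 the CELLS on `InPointClass` (`schanuel_inPointClass`, `eStableDefectOne_pointCell`, `plainDefectOne_pointCell`, `defectOneSchanuel_pointCell`, `coordLiouvilleSchanuel_pointCell`); §6 the MEMBERS `zH4 = λ_H·(1, √2, i, i√2)`, `zH3` (`zH4_inPointClass`, `zH4_eStable`, `schanuel_at_zH4`, `item31409_applied_at_zH4`, `item31409_instance_at_zH4'`)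

(lens-2 g36 `PointTransfer.lean` v2, sha256 3559bc07…2e21, own farm rc 0 · 0 sorry · axioms std; critic VERDICT STATUS L1667 PORT GO LOW;
port by census-1 gen 15 in four parts `RootDecomp1EPointTransfer01`–`04` — see the PORT NOTE of part 01; `--supports stmt-Schanuel-31409`; rung 0.)
-/

noncomputable section

open Complex IntermediateField
open Summit.Schanuel.Schanuel.Theorems.RootDecomp1KHyper (SB SFset mvlen mvlen_nonneg abs_coeff_le_mvlen
  one_le_mvlen sb_of_algebraicIndependent exists_le_two_pow exists_int_mul_eq_map mvaeval_int_map
  mem_adjoin_SFset_I')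
open Summit.Schanuel.Schanuel.Theorems.RootDecomp1KHyper.HyperCell (HyperLiouville hexp hexp_succ lambdaH
  hyperLiouville_lambdaH lambdaH_partialSum lambdaH_tail_pos lambdaH_tail_le lambdaH_eq_partialSum_add_tail
  summable_lambdaH succ_le_hexp one_le_hexp)
open Summit.Schanuel.Schanuel.Theorems.RootDecomp1EScaleTransfer (expPoly prod_exp_pow_eq expPoly_eq_sum
  differentiable_expPoly exists_lipschitz_expPoly linearIndependent_scale linearIndependent_of_scale s2 s2_mul_s2 ω4 y3
  isAlgebraic_s2 ω4_algebraic ω4_linearIndependent y3_linearIndependent s2_not_rat y3_zero y3_one y3_two ih_at_three)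

namespace Summit.Schanuel.Schanuel.Theorems.RootDecomp1EPointTransfer

/-! ## §5 The CELLS of the 1E items (and of 1K's S_L′) on the class `InPointClass` -/

/-- **`OnHyperLine z`** — the ENGINE's class: `z = ξ · y` with `y ∈ ℚ̄ⁿ` ℚ-free and `ξ` a hyper-rational
scale. -/
def OnHyperLine {n : ℕ} (z : Fin n → ℂ) : Prop :=
  ∃ (y : Fin n → ℂ) (ξ : ℂ), (∀ j, IsAlgebraic ℚ (y j)) ∧ LinearIndependent ℚ y ∧ HyperRatScale ξ ∧
    z = fun j => ξ * y j

/-- **`InPointClass z`** — THE CELL LINE (stated with lens 6's TREE predicate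
`RootDecomp1KHyper.HyperCell.HyperLiouville`, not a copy): `z = ρ · y` with `ρ` a real HYPER-LIOUVILLE
number (`|ρ − p/q| < exp(−q^m)` for every `m`, `q ≥ m`) and `y ∈ ℚ̄ⁿ` ℚ-linearly independent. -/
def InPointClass {n : ℕ} (z : Fin n → ℂ) : Prop :=
  ∃ (ρ : ℝ) (y : Fin n → ℂ), HyperLiouville ρ ∧ (∀ j, IsAlgebraic ℚ (y j)) ∧ LinearIndependent ℚ y ∧
    z = fun j => (ρ : ℂ) * y j

/-- A point-class tuple lies on a hyper-Liouville line. -/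
theorem InPointClass.onHyperLine {n : ℕ} {z : Fin n → ℂ} (h : InPointClass z) : OnHyperLine z := by
  obtain ⟨ρ, y, hρ, hyalg, hy, rfl⟩ := h
  exact ⟨y, ρ, hyalg, hy, hyperRatScale_of_hyperLiouville hρ, rfl⟩

/-- `ρ·y` is in the point class for `ρ` hyper-Liouville and `y` an algebraic ℚ-free frame. -/
theorem inPointClass_of_hyperLiouville {n : ℕ} {y : Fin n → ℂ} (hyalg : ∀ j, IsAlgebraic ℚ (y j))
    (hy : LinearIndependent ℚ y) {ρ : ℝ} (hρ : HyperLiouville ρ) :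
    InPointClass (fun j => (ρ : ℂ) * y j) :=
  ⟨ρ, y, hρ, hyalg, hy, rfl⟩

/-- Bottom rung of the engine's class: algebraic ℚ-free tuples (`ξ = 1`) — Lindemann–Weierstrass. -/
theorem onHyperLine_of_algebraic {n : ℕ} {z : Fin n → ℂ} (hzalg : ∀ i, IsAlgebraic ℚ (z i))
    (hz : LinearIndependent ℚ z) : OnHyperLine z :=
  ⟨z, 1, hzalg, hz, hyperRatScale_one, funext fun _ => (one_mul _).symm⟩

/-- **`S` ITSELF on the engine's class, at EVERY length** (mod `hRoy`). -/
theorem schanuel_onHyperLine (hRoy : Roy2014_thm_1_1) (n : ℕ) (z : Fin n → ℂ)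
    (hz : LinearIndependent ℚ z) (hcls : OnHyperLine z) :
    (n : Cardinal) ≤ Algebra.trdeg ℚ
      ↥(IntermediateField.adjoin ℚ (Set.range z ∪ Set.range (cexp ∘ z))) := by
  obtain ⟨y, ξ, hyalg, hy, hξ, rfl⟩ := hcls
  exact sb_of_hyperRatScale hRoy hyalg hy hξ

/-- **CELL THEOREM — `S` ITSELF on `InPointClass`, at EVERY length** (mod `hRoy`). -/
theorem schanuel_inPointClass (hRoy : Roy2014_thm_1_1) (n : ℕ) (z : Fin n → ℂ)
    (hz : LinearIndependent ℚ z) (hcls : InPointClass z) :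
    (n : Cardinal) ≤ Algebra.trdeg ℚ
      ↥(IntermediateField.adjoin ℚ (Set.range z ∪ Set.range (cexp ∘ z))) :=
  schanuel_onHyperLine hRoy n z hz hcls.onHyperLine

/-- **The class is closed under passing to ℚ-free tuples in the ℚ-span** (same scale, new algebraic
frame): the induction binders of 31409 / 31410 are therefore discharged INSIDE the class. -/
theorem InPointClass.of_mem_span {n m : ℕ} {z : Fin n → ℂ} (hcls : InPointClass z) {w : Fin m → ℂ}
    (hw : LinearIndependent ℚ w) (hmem : ∀ j, w j ∈ Submodule.span ℚ (Set.range z)) :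
    InPointClass w := by
  obtain ⟨ρ, y, hρ, hyalg, hy, rfl⟩ := hcls
  have hc : ∀ j, ∃ c : Fin n → ℚ, ∑ i, c i • ((ρ : ℂ) * y i) = w j := fun j =>
    (Submodule.mem_span_range_iff_exists_fun ℚ).mp (hmem j)
  choose c hc using hc
  have hw' : w = fun j => (ρ : ℂ) * ∑ i, (c j i : ℂ) * y i := by
    funext j; rw [← hc j, Finset.mul_sum]
    exact Finset.sum_congr rfl fun i _ => by rw [Rat.smul_def]; ring
  refine ⟨ρ, fun j => ∑ i, (c j i : ℂ) * y i, hρ, fun j => ?_, ?_, hw'⟩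
  · rw [← mem_algebraicClosure_iff]
    refine Subalgebra.sum_mem _ fun i _ => ?_
    refine Subalgebra.mul_mem _ ?_ (mem_algebraicClosure_iff.mpr (hyalg i))
    exact mem_algebraicClosure_iff.mpr (isAlgebraic_algebraMap (c j i))
  · rw [hw'] at hw
    exact linearIndependent_of_scale hw

/-- **The induction binder of 31409 / 31410 discharged on the class** (mod `hRoy`): every ℚ-free tuple in
the ℚ-span of a class member satisfies `S` (hence `S + 1`). -/
theorem ih_of_inPointClass (hRoy : Roy2014_thm_1_1) {n : ℕ} {z : Fin n → ℂ} (hcls : InPointClass z) :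
    ∀ (m : ℕ) (w : Fin m → ℂ), m < n → LinearIndependent ℚ w →
      (∀ j, w j ∈ Submodule.span ℚ (Set.range z)) →
      (m : Cardinal) ≤ Algebra.trdeg ℚ ↥(IntermediateField.adjoin ℚ
        (Set.range w ∪ Set.range (Complex.exp ∘ w))) + 1 :=
  fun m w _ hw hmem => (schanuel_inPointClass hRoy m w hw (hcls.of_mem_span hw hmem)).trans le_self_add

/-- **CELL of item 25020 `DefectOneSchanuel` (S⁻)** — binders verbatim, `InPointClass z` inserted after
`LinearIndependent ℚ z`. -/
theorem defectOneSchanuel_pointCell (hRoy : Roy2014_thm_1_1) :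
    ∀ (n : ℕ) (z : Fin n → ℂ), LinearIndependent ℚ z → InPointClass z →
      (n : Cardinal) ≤ Algebra.trdeg ℚ
        ↥(IntermediateField.adjoin ℚ (Set.range z ∪ Set.range (Complex.exp ∘ z))) + 1 :=
  fun n z hz hcls => (schanuel_inPointClass hRoy n z hz hcls).trans le_self_add

/-- **CELL of item 31409 `EStableDefectOne`** — binders verbatim (E-stability and the induction binder
carried, unused), `InPointClass z` inserted after `LinearIndependent ℚ z`. -/
theorem eStableDefectOne_pointCell (hRoy : Roy2014_thm_1_1) :
    ∀ (n : ℕ) (z : Fin n → ℂ), LinearIndependent ℚ z → InPointClass z →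
      (∃ β : ℂ, IsAlgebraic ℚ β ∧ β ∉ Set.range (algebraMap ℚ ℂ) ∧
        ∀ i, β * z i ∈ Submodule.span ℚ (Set.range z)) →
      (∀ (m : ℕ) (w : Fin m → ℂ), m < n → LinearIndependent ℚ w →
        (∀ j, w j ∈ Submodule.span ℚ (Set.range z)) →
        (m : Cardinal) ≤ Algebra.trdeg ℚ ↥(IntermediateField.adjoin ℚ
          (Set.range w ∪ Set.range (Complex.exp ∘ w))) + 1) →
      (n : Cardinal) ≤ Algebra.trdeg ℚ ↥(IntermediateField.adjoin ℚ
        (Set.range z ∪ Set.range (Complex.exp ∘ z))) + 1 :=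
  fun n z hz hcls _ _ => (schanuel_inPointClass hRoy n z hz hcls).trans le_self_add

/-- **CELL of item 31410 `PlainDefectOne`** — binders verbatim (plainness carried, unused),
`InPointClass z` inserted after `LinearIndependent ℚ z`. -/
theorem plainDefectOne_pointCell (hRoy : Roy2014_thm_1_1) :
    ∀ (n : ℕ) (z : Fin n → ℂ), LinearIndependent ℚ z → InPointClass z →
      (∀ β : ℂ, IsAlgebraic ℚ β → (∀ i, β * z i ∈ Submodule.span ℚ (Set.range z)) →
        β ∈ Set.range (algebraMap ℚ ℂ)) →
      (∀ (m : ℕ) (w : Fin m → ℂ), m < n → LinearIndependent ℚ w →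
        (∀ j, w j ∈ Submodule.span ℚ (Set.range z)) →
        (m : Cardinal) ≤ Algebra.trdeg ℚ ↥(IntermediateField.adjoin ℚ
          (Set.range w ∪ Set.range (Complex.exp ∘ w))) + 1) →
      (n : Cardinal) ≤ Algebra.trdeg ℚ ↥(IntermediateField.adjoin ℚ
        (Set.range z ∪ Set.range (Complex.exp ∘ z))) + 1 :=
  fun n z hz hcls _ _ => (schanuel_inPointClass hRoy n z hz hcls).trans le_self_add

/-- **CELL of route 1K's item 31077 `CoordLiouvilleSchanuel` (S_L′)** — binders verbatim (the
Liouville-coordinate binder carried, unused), `InPointClass z` inserted after `LinearIndependent ℚ z`: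
the part of S_L′'s scope where NO coordinate is algebraic and EVERY `e^{z_j}` is load-bearing. -/
theorem coordLiouvilleSchanuel_pointCell (hRoy : Roy2014_thm_1_1) :
    ∀ (n : ℕ) (z : Fin n → ℂ), LinearIndependent ℚ z → InPointClass z →
      (∃ w ∈ Submodule.span ℚ (Set.range z), Liouville w.re ∨ Liouville w.im) →
      (n : Cardinal) ≤ Algebra.trdeg ℚ
        ↥(IntermediateField.adjoin ℚ (Set.range z ∪ Set.range (Complex.exp ∘ z))) :=
  fun n z hz hcls _ => schanuel_inPointClass hRoy n z hz hcls

/-! ## §6 The MEMBERS `z_H⁽⁴⁾ = λ_H · (1, √2, i, i√2)` (n = 4, E-stable) and `z_H⁽³⁾ = λ_H · (1, √2, i)`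
(n = 3, plain), on the scale `λ_H = Σ_k 2^{−a_k}`, `a₀ = 1`, `a_{k+1} = 2^{(k+1)a_k}` (lens 6, tree) -/

/-- `i` is algebraic. -/
private theorem isAlgebraic_I' : IsAlgebraic ℚ I :=
  ⟨Polynomial.X ^ 2 - Polynomial.C (-1), Polynomial.X_pow_sub_C_ne_zero (by norm_num) _, by simp⟩

/-- The frame `y3 = (1, √2, i)` consists of algebraic numbers. -/
theorem y3_algebraic : ∀ j, IsAlgebraic ℚ (y3 j) := fun _ => ω4_algebraic _

/-- `a + b√2 = 0` with `a, b ∈ ℚ` forces `a = b = 0`. -/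
private theorem rat_sqrt_two {a b : ℚ} (h : (a : ℝ) + b * Real.sqrt 2 = 0) : a = 0 ∧ b = 0 := by
  by_cases hb : b = 0
  · subst hb
    simp at h
    exact ⟨by exact_mod_cast h, rfl⟩
  · exfalso
    apply irrational_sqrt_two
    refine ⟨-a / b, ?_⟩
    have hb' : (b : ℝ) ≠ 0 := by exact_mod_cast hb
    push_cast
    field_simp
    linarith

/-- **THE MEMBERS.** -/
def zH4 : Fin 4 → ℂ := fun j => (lambdaH : ℂ) * ω4 j
/-- The member triple `z_H⁽³⁾ = λ_H · (1, √2, i)`. -/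
def zH3 : Fin 3 → ℂ := fun j => (lambdaH : ℂ) * y3 j

/-- `λ_H > 0`. -/
private theorem lambdaH_pos : 0 < lambdaH :=
  summable_lambdaH.tsum_pos (fun k => by positivity) 0 (by positivity)

/-- `λ_H ≠ 0` in `ℂ`. -/
private theorem lambdaH_ne_zero : (lambdaH : ℂ) ≠ 0 := Complex.ofReal_ne_zero.mpr lambdaH_pos.ne'

/-- `z_H⁽⁴⁾` is ℚ-linearly independent. -/
theorem zH4_linearIndependent : LinearIndependent ℚ zH4 :=
  linearIndependent_scale lambdaH_ne_zero ω4_linearIndependent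

/-- `z_H⁽³⁾` is ℚ-linearly independent. -/
theorem zH3_linearIndependent : LinearIndependent ℚ zH3 :=
  linearIndependent_scale lambdaH_ne_zero y3_linearIndependent

/-- **Class certificates of the members** (hypothesis-free; the scale certificate is lens 6's TREE
theorem `hyperLiouville_lambdaH`, cited not copied). -/
theorem zH4_inPointClass : InPointClass zH4 :=
  inPointClass_of_hyperLiouville ω4_algebraic ω4_linearIndependent hyperLiouville_lambdaH

/-- `z_H⁽³⁾` lies in the point class. -/
theorem zH3_inPointClass : InPointClass zH3 :=
  inPointClass_of_hyperLiouville y3_algebraic y3_linearIndependent hyperLiouville_lambdaH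

/-- The members carry a LIOUVILLE COORDINATE (`z₀ = λ_H`): they lie in the scope of 1K's S_L′ (31077). -/
theorem zH4_coordLiouville : ∃ w ∈ Submodule.span ℚ (Set.range zH4), Liouville w.re ∨ Liouville w.im :=
  ⟨zH4 0, Submodule.subset_span ⟨0, rfl⟩, Or.inl (by
    simpa [zH4, ω4] using hyperLiouville_lambdaH.liouville)⟩

/-- `z_H⁽³⁾` has a Liouville coordinate in its ℚ-span (scope of 1K's item 31077). -/
theorem zH3_coordLiouville : ∃ w ∈ Submodule.span ℚ (Set.range zH3), Liouville w.re ∨ Liouville w.im :=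
  ⟨zH3 0, Submodule.subset_span ⟨0, rfl⟩, Or.inl (by
    simpa [zH3, y3, ω4] using hyperLiouville_lambdaH.liouville)⟩

/-- **E-stability certificate of `z_H⁽⁴⁾`** (`β = √2`): the tuple is a line over `ℚ(√2, i)`. -/
theorem zH4_eStable : ∃ β : ℂ, IsAlgebraic ℚ β ∧ β ∉ Set.range (algebraMap ℚ ℂ) ∧
    ∀ i, β * zH4 i ∈ Submodule.span ℚ (Set.range zH4) := by
  refine ⟨s2, isAlgebraic_s2, s2_not_rat, fun i => ?_⟩
  have mem : ∀ j, zH4 j ∈ Submodule.span ℚ (Set.range zH4) :=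
    fun j => Submodule.subset_span ⟨j, rfl⟩
  have h2 := s2_mul_s2
  fin_cases i
  · show s2 * zH4 0 ∈ _
    have e : s2 * zH4 0 = zH4 1 := by simp [zH4, ω4]; ring
    rw [e]; exact mem 1
  · show s2 * zH4 1 ∈ _
    have e : s2 * zH4 1 = (2 : ℚ) • zH4 0 := by
      simp [zH4, ω4, Rat.smul_def]; linear_combination (lambdaH : ℂ) * h2
    rw [e]; exact Submodule.smul_mem _ _ (mem 0)
  · show s2 * zH4 2 ∈ _
    have e : s2 * zH4 2 = zH4 3 := by simp [zH4, ω4]; ring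
    rw [e]; exact mem 3
  · show s2 * zH4 3 ∈ _
    have e : s2 * zH4 3 = (2 : ℚ) • zH4 2 := by
      simp [zH4, ω4, Rat.smul_def]; linear_combination ((lambdaH : ℂ) * I) * h2
    rw [e]; exact Submodule.smul_mem _ _ (mem 2)

/-- **`S` at the member `z_H⁽⁴⁾` (n = 4):** `e^{λ_H}, e^{λ_H√2}, e^{iλ_H}, e^{iλ_H√2}` are algebraically
independent (mod `hRoy`) — a DECIDED quartic E-line of item 31409's first open length `n = 4` whose scale
is hyper-Liouville of SINGLE-exponential type. -/
theorem schanuel_at_zH4 (hRoy : Roy2014_thm_1_1) : SB 4 zH4 :=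
  schanuel_inPointClass hRoy 4 zH4 zH4_linearIndependent zH4_inPointClass

/-- **`S` at the member `z_H⁽³⁾` (n = 3).** -/
theorem schanuel_at_zH3 (hRoy : Roy2014_thm_1_1) : SB 3 zH3 :=
  schanuel_inPointClass hRoy 3 zH3 zH3_linearIndependent zH3_inPointClass

/-- **Item 31409 `EStableDefectOne` APPLIED to the member** — `zH4_linearIndependent`, `zH4_eStable` ARE the
item's scope hypotheses at `z := zH4`, `n := 4`; the induction binder stays a parameter. -/
theorem item31409_applied_at_zH4 (h31409 : Summit.Schanuel.Schanuel.Theses.RootDecomp1E.EStableDefectOne)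
    (hIH : ∀ (m : ℕ) (w : Fin m → ℂ), m < 4 → LinearIndependent ℚ w →
        (∀ j, w j ∈ Submodule.span ℚ (Set.range zH4)) →
        (m : Cardinal) ≤ Algebra.trdeg ℚ ↥(IntermediateField.adjoin ℚ
          (Set.range w ∪ Set.range (Complex.exp ∘ w))) + 1) :
    ((4 : ℕ) : Cardinal) ≤ Algebra.trdeg ℚ ↥(IntermediateField.adjoin ℚ
        (Set.range zH4 ∪ Set.range (Complex.exp ∘ zH4))) + 1 :=
  h31409 4 zH4 zH4_linearIndependent zH4_eStable hIH

/-- … and the cell theorem DISCHARGES the same instance (mod `hRoy`). -/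
theorem item31409_instance_at_zH4 (hRoy : Roy2014_thm_1_1)
    (hIH : ∀ (m : ℕ) (w : Fin m → ℂ), m < 4 → LinearIndependent ℚ w →
        (∀ j, w j ∈ Submodule.span ℚ (Set.range zH4)) →
        (m : Cardinal) ≤ Algebra.trdeg ℚ ↥(IntermediateField.adjoin ℚ
          (Set.range w ∪ Set.range (Complex.exp ∘ w))) + 1) :
    ((4 : ℕ) : Cardinal) ≤ Algebra.trdeg ℚ ↥(IntermediateField.adjoin ℚ
        (Set.range zH4 ∪ Set.range (Complex.exp ∘ zH4))) + 1 :=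
  eStableDefectOne_pointCell hRoy 4 zH4 zH4_linearIndependent zH4_inPointClass zH4_eStable hIH

/-- **… and with the induction binder DISCHARGED as well** (`ih_of_inPointClass`): the 31409 instance at
`z_H⁽⁴⁾` holds outright mod `hRoy`. -/
theorem item31409_instance_at_zH4' (hRoy : Roy2014_thm_1_1) :
    ((4 : ℕ) : Cardinal) ≤ Algebra.trdeg ℚ ↥(IntermediateField.adjoin ℚ
        (Set.range zH4 ∪ Set.range (Complex.exp ∘ zH4))) + 1 :=
  eStableDefectOne_pointCell hRoy 4 zH4 zH4_linearIndependent zH4_inPointClass zH4_eStable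
    (ih_of_inPointClass hRoy zH4_inPointClass)

end Summit.Schanuel.Schanuel.Theorems.RootDecomp1EPointTransfer
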